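import Mathlib
import HarnessLib
import Literature.NumberTheory.LFunctions.RHWave0

/-!
# Mikolás's "familiar identities" for the dilated Mertens sums `M(⌊x/n⌋)`

Topic `NumberTheory/Multiplicative`; **proof file** (theorems only; no definitions, no named facts).

With `M(y) = ∑_{m ≤ y} μ(m)` the Mertens function and `Φ(x) = ∑_{n ≤ x} φ(n)` the number of Farey
fractions of order `x` in `(0, 1]`, Mikolás (1949, p. 99, "the familiar identities, arising
immediately from (1)" `= ∑_{d ∣ n} μ(d) = [n = 1]`) records, for every integer `x ≥ 1`,

* (5)  `∑_{n ≤ x} M(⌊x/n⌋) = 1`  — `sum_mertens_div_eq_one`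
  (`sum_mertensFunction_div_eq_one` in the tree's vocabulary `LFunctions.mertensFunction`);
* (6)  `Φ(x) = ½ ∑_{n ≤ x} μ(n) ⌊x/n⌋² + ½`  — `two_mul_totientSum_eq`;

and the layering identity behind Lemma 4 / the Farey discrepancy,

* `∑_{a ≤ x} a · M(⌊x/a⌋) = Φ(x)`  — `sum_mul_mertens_div_eq_totientSum`,

all three being `φ = μ ∗ N` resp. `μ ∗ 𝟙 = δ` summed over `n ≤ x` (Mathlib's
`ArithmeticFunction.sum_Ioc_mul_eq_sum_sum`).  These are exactly the identities the census adapter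
for Mikolás's Farey/Franel objects asserts level by level; here they hold for all `x`.
Also: `sum_moebius_mul_div_eq_one` — `∑_{n ≤ x} μ(n) ⌊x/n⌋ = 1` (in `ℤ`; the tree has an `ℝ`
version, `Literature.Barriers.RiemannHypothesis.sum_moebius_mul_div_eq_one`).

## References

* [Mikolas1949] M. Mikolás, *Farey series and their connection with the prime number problem. I*,
  Acta Sci. Math. (Szeged) 13 (1949) 93–117: p. 98 Lemma 3 (eq. (4)), Lemma 4; p. 99 eqs. (5),
  (6) (read at page, SZTE repository scan).

## Mathlib / tree search

`ArithmeticFunction.sum_Ioc_mul_eq_sum_sum`, `ArithmeticFunction.sum_Ioc_mul_zeta_eq_sum`,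
`ArithmeticFunction.coe_zeta_mul_moebius`, `ArithmeticFunction.sum_eq_iff_sum_mul_moebius_eq`,
`Nat.sum_totient`; tree: `LFunctions.mertensFunction` (`RHWave0.lean`); the private lemma
`Redheffer.sum_sum_moebius_div_eq_one` of `RedhefferMatrix.lean` is (5) (re-proved publicly here).
-/

open Finset
open scoped ArithmeticFunction.Moebius

namespace Literature.NumberTheory.Multiplicative

namespace Mikolas1949

/-! ## `μ ∗ 𝟙 = δ` summed: (5) and `∑ μ(n)⌊x/n⌋ = 1` -/

/-- **Mikolás (5)**: `∑_{n ≤ x} M(⌊x/n⌋) = 1` for every integer `x ≥ 1`, with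
`M(N) = ∑_{m ≤ N} μ(m)`. [cite: Mikolas1949, p. 99 eq. (5)] -/
theorem sum_mertens_div_eq_one {x : ℕ} (hx : 0 < x) :
    ∑ n ∈ Ioc 0 x, ∑ m ∈ Ioc 0 (x / n), μ m = 1 := by
  have h := ArithmeticFunction.sum_Ioc_mul_eq_sum_sum
    (ArithmeticFunction.zeta : ArithmeticFunction ℤ) (μ : ArithmeticFunction ℤ) x
  rw [ArithmeticFunction.coe_zeta_mul_moebius] at h
  have h1 : ∑ n ∈ Ioc 0 x, (1 : ArithmeticFunction ℤ) n = 1 := by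
    rw [Finset.sum_eq_single_of_mem 1 (Finset.mem_Ioc.2 ⟨Nat.one_pos, hx⟩)]
    · simp
    · intro b _ hb
      simp [hb]
  rw [h1] at h
  rw [h]
  refine Finset.sum_congr rfl fun d hd => ?_
  have hd0 : d ≠ 0 := (Finset.mem_Ioc.1 hd).1.ne'
  rw [ArithmeticFunction.natCoe_apply, ArithmeticFunction.zeta_apply, if_neg hd0, Nat.cast_one,
    one_mul]

/-- (5) in the tree's vocabulary: `∑_{n ≤ x} M(⌊x/n⌋) = 1`, `M = LFunctions.mertensFunction`,
`x ≥ 1`. [cite: Mikolas1949, p. 99 eq. (5)] -/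
theorem sum_mertensFunction_div_eq_one {x : ℕ} (hx : 0 < x) :
    ∑ n ∈ Ioc 0 x, LFunctions.mertensFunction ((x / n : ℕ) : ℝ) = 1 := by
  simp_rw [LFunctions.mertensFunction, Nat.floor_natCast]
  exact sum_mertens_div_eq_one hx

/-- `∑_{n ≤ x} μ(n) ⌊x/n⌋ = 1` for `x ≥ 1` (the same identity with the order of summation
exchanged). [cite: Mikolas1949, p. 99 (from (1))] -/
theorem sum_moebius_mul_div_eq_one {x : ℕ} (hx : 0 < x) :
    ∑ n ∈ Ioc 0 x, μ n * ((x / n : ℕ) : ℤ) = 1 := by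
  have h := ArithmeticFunction.sum_Ioc_mul_zeta_eq_sum (μ : ArithmeticFunction ℤ) x
  rw [ArithmeticFunction.moebius_mul_coe_zeta] at h
  have h1 : ∑ n ∈ Ioc 0 x, (1 : ArithmeticFunction ℤ) n = 1 := by
    rw [Finset.sum_eq_single_of_mem 1 (Finset.mem_Ioc.2 ⟨Nat.one_pos, hx⟩)]
    · simp
    · intro b _ hb
      simp [hb]
  rw [h1] at h
  exact h.symm

/-! ## `φ = μ ∗ N` summed: `∑ a·M(⌊x/a⌋) = Φ(x)` and (6) -/

/-- `(μ ∗ N)(n) = φ(n)` (Möbius inversion of `∑_{d ∣ n} φ(d) = n`), pointwise. [folklore] -/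
private theorem moebius_mul_coe_id_apply (n : ℕ) :
    ((μ : ArithmeticFunction ℤ) * ((ArithmeticFunction.id : ArithmeticFunction ℕ) :
      ArithmeticFunction ℤ)) n = (Nat.totient n : ℤ) := by
  rcases Nat.eq_zero_or_pos n with rfl | hn
  · simp
  rw [ArithmeticFunction.mul_apply]
  have hinv := (ArithmeticFunction.sum_eq_iff_sum_mul_moebius_eq
    (f := fun m : ℕ => (Nat.totient m : ℤ)) (g := fun m : ℕ => (m : ℤ))).1
    (fun m _ => by rw [← Nat.cast_sum, Nat.sum_totient]) n hn
  rw [← hinv]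
  refine Finset.sum_congr rfl fun y _ => ?_
  rw [ArithmeticFunction.natCoe_apply, ArithmeticFunction.id_apply, Int.cast_id]

/-- **`∑_{a ≤ x} a · M(⌊x/a⌋) = Φ(x) = ∑_{n ≤ x} φ(n)`** (the Möbius/Mertens layering of the
Farey count; Mikolás Lemma 3 with `f ≡ 1`, i.e. `φ = μ ∗ N` summed over `n ≤ x`).
[cite: Mikolas1949, p. 98 Lemma 3 (4) and Lemma 4] -/
theorem sum_mul_mertens_div_eq_totientSum (x : ℕ) :
    ∑ a ∈ Ioc 0 x, (a : ℤ) * ∑ m ∈ Ioc 0 (x / a), μ m = ∑ n ∈ Ioc 0 x, (Nat.totient n : ℤ) := by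
  have h := ArithmeticFunction.sum_Ioc_mul_eq_sum_sum
    ((ArithmeticFunction.id : ArithmeticFunction ℕ) : ArithmeticFunction ℤ)
    (μ : ArithmeticFunction ℤ) x
  rw [mul_comm] at h
  simp only [moebius_mul_coe_id_apply] at h
  rw [h]
  refine Finset.sum_congr rfl fun a _ => ?_
  rw [ArithmeticFunction.natCoe_apply, ArithmeticFunction.id_apply]

/-- `2 ∑_{m ≤ N} m = N (N + 1)`. [folklore] -/
private theorem two_mul_sum_Ioc (N : ℕ) : 2 * ∑ m ∈ Ioc 0 N, (m : ℤ) = N * (N + 1) := by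
  induction N with
  | zero => simp
  | succ N ih =>
    rw [Finset.sum_Ioc_succ_top (Nat.zero_le N), mul_add, ih]
    push_cast
    ring

/-- **Mikolás (6)**: `2 Φ(x) = ∑_{n ≤ x} μ(n) ⌊x/n⌋² + 1` for `x ≥ 1`, i.e.
`Φ(x) = ½ ∑ μ(n) [x/n]² + ½`. [cite: Mikolas1949, p. 99 eq. (6)] -/
theorem two_mul_totientSum_eq {x : ℕ} (hx : 0 < x) :
    2 * ∑ n ∈ Ioc 0 x, (Nat.totient n : ℤ) =
      ∑ n ∈ Ioc 0 x, μ n * ((x / n : ℕ) : ℤ) ^ 2 + 1 := by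
  have h := ArithmeticFunction.sum_Ioc_mul_eq_sum_sum (μ : ArithmeticFunction ℤ)
    ((ArithmeticFunction.id : ArithmeticFunction ℕ) : ArithmeticFunction ℤ) x
  simp only [moebius_mul_coe_id_apply, ArithmeticFunction.natCoe_apply,
    ArithmeticFunction.id_apply] at h
  rw [h, Finset.mul_sum, ← sum_moebius_mul_div_eq_one hx, ← Finset.sum_add_distrib]
  refine Finset.sum_congr rfl fun n _ => ?_
  rw [mul_left_comm, two_mul_sum_Ioc]
  push_cast
  ring

end Mikolas1949

end Literature.NumberTheory.Multiplicative
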